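/- Copyright: the b2b-balaban cell (near-miss cell 7), T⁴-continuum fan-out, lineage t4-ne7b-formalise-leaf-04 (NE7b
CRUX team (2), leaf prover 04) on the row-NE7b OWNER's INTERFACE REQUEST NE7b IR-41-8 «M2 brick B», part 1 of 2 (the
process-generic bridge, split off by the 400-line rule).  Released under the licence of the surrounding project. -/
import Summits.QuantumFields.BalabanUV.T4Continuum.Support.HistoryGenealogyJunction
import Summits.QuantumFields.BalabanUV.T4Continuum.Support.HistoryGenealogyExtractionRLedger

/-!
# THE EVENT PRODUCT OF THE END-CURRENCY GENEALOGY IS PRINT'S EXTRACTION'S (`evProd_toPGen_eq_pgenR`) — pedigree layer,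
process-generic; INTERFACE REQUEST NE7b IR-41-8 «M2 brick B» of the row owner `t4-ne7b-p1` gen 41, part 1 of 2 (part 2 =
`B16HistoryInputFamily`, which consumes it); lineage `t4-ne7b-formalise-leaf-04` gen 25 — PRE-POSITIONING ONLY

Summits-side support leaf of the T⁴-continuum cell (rung (B)+1 on a FINITE torus only; NOT infinite volume, NOT the
mass gap, NOT Clay; NOT a proof of NE7b — the cell's OWN estimate, NOT PRINTED, NOT PROVED).  [folklore] finite
combinatorics over the owner's pedigree layer (`HistoryGenealogyPedigree`: `pedOf`, `OrderOK`, `toPGen_succ`,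
`toPGen_zero`, `mem_parts_of_inl_mem_ord`; `…PedigreeHead`: `ord_ne_nil`, `rights_ord_zero_ne_nil`; `…PedigreeOrder`:
`orderOK_ordOf`), its extraction ledger (`HistoryGenealogyExtractionR`∕`…RLedger`: `pgenR`, `constituentsR`, `wrapR`,
`assembleR`, `evProd`, `evProd_assembleR`), the END's bridge (`HistoryGenBridge`: `chainJoin`, `Pedigree.joinP`) and
leaf-05's process (`HistoryGenealogyInstantiateM*`: `RunInputM.pedM`∕`ordM`, `wf_histM`, `levelClausesW_histM`);
nothing printed is asserted, no `def … : Prop` fact, no cite tag, zero `sorry`.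

WHAT.  The owner's M4 proved that `(pedOf H rnw ord).toPGen cell (j, c)` and print's extraction `H.pgenR rnw j c` have
the same last step (`lastStep_toPGen_eq_pgenR`) and root step (`rootStep_toPGen_eq_pgenR`) for ANY admissible order.
THIS FILE adds the multiplicative twin M2 brick B needs to move the forest identity `forest_evProd_eqR` (stated over
`pgenR`) into the END's `Pedigree` currency: **`evProd_toPGen_eq_pgenR`** — the EVENT PRODUCTS agree (births re-celled
by `cell`), by the same induction on the level (a commutative product forgets the order: `List.Perm.prod_eq` on the
owner's `OrderOK` permutation); helpers `evProd_chainJoin`, `evProd_joinP`, `rights_eq_filterMap`, `perm_rights`; the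
identity-payload form **`evProd_toPGen_id_eq_pgenR`** and, for the process, **`RunInputM.evProd_pedM_eq_pgenR`** (the
chosen order `ordM` is admissible under `NewOK` and memory domination `Rm ≤ R` — the owner's binders verbatim).

HONEST.  Proves nothing of Bałaban's; BY-NAME EFFECT ON THE WALL: NONE; NE7b NOT proved; spine 0∕9.  HONEST DEPENDENCY
(cell): continuum YM on T⁴ ⇐ BetaPertH ∧ nine spine estimates (0/9 proved); BetaPertH ⇐ (D1) ∧ (D4) ∧ CAP+tail; G-an2-4
gates asym, D1 and NE2/3/4.  This file changes none of it.
-/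

open Summit.QuantumFields.BalabanUV.T4Continuum.HistoryAdmissible
open Summit.QuantumFields.BalabanUV.T4Continuum.HistoryGen
open Summit.QuantumFields.BalabanUV.T4Continuum.HistoryGenealogyExtraction
open Summit.QuantumFields.BalabanUV.T4Continuum.HistoryGenealogyRealise
open Summit.QuantumFields.BalabanUV.T4Continuum.HistoryGenealogyInstantiate

/-! ## The bridge -/

namespace Summit.QuantumFields.BalabanUV.T4Continuum.HistoryGenealogyPedigree

section EvProdBridge

variable {γ δ M : Type*} [CommMonoid M] (fB : ℕ → ℕ → δ → M) (fR : ℕ → M)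

/-- the event product of a chain of joins is the product over the chained genealogies [folklore] -/
theorem evProd_chainJoin (s : ℕ) : ∀ (A : PGen δ) (Bs : List (PGen δ)),
    evProd fB fR (chainJoin A Bs s) = evProd fB fR A * (Bs.map (evProd fB fR)).prod
  | A, [] => by simp [chainJoin]
  | A, B :: Bs => by
      rw [chainJoin, evProd_chainJoin s (PGen.join A B s) Bs, evProd_join, List.map_cons, List.prod_cons, mul_assoc]

/-- the event product of the join of a NONEMPTY list of part genealogies is the product over the list [folklore] -/
theorem evProd_joinP {α π : Type*} [Inhabited δ] (P : Pedigree α π) (c : α) :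
    ∀ {L : List (PGen δ)}, L ≠ [] → evProd fB fR (P.joinP c L) = (L.map (evProd fB fR)).prod
  | [], h => (h rfl).elim
  | A :: As, _ => by rw [Pedigree.joinP, evProd_chainJoin, List.map_cons, List.prod_cons]

/-- `rights` is a `filterMap`, hence respects permutations [folklore] -/
theorem rights_eq_filterMap {α β : Type*} : ∀ l : List (α ⊕ β), rights l = l.filterMap Sum.getRight?
  | [] => rfl
  | Sum.inl a :: l => by rw [rights_cons_inl, List.filterMap_cons_none (by rfl), rights_eq_filterMap l]
  | Sum.inr b :: l => by rw [rights_cons_inr, List.filterMap_cons_some (by rfl), rights_eq_filterMap l]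

/-- permuted lists have permuted `rights` [folklore] -/
theorem perm_rights {α β : Type*} {l l' : List (α ⊕ β)} (h : l.Perm l') : (rights l).Perm (rights l') := by
  rw [rights_eq_filterMap, rights_eq_filterMap]; exact h.filterMap _

variable [DecidableEq γ] [Inhabited δ] {H : ComponentHistory γ} {rnw : ℕ → γ → Bool} {ord : ℕ → γ → List (γ ⊕ γ)}
  (cell : γ → δ)

/-- **THE EVENT PRODUCT OF `toPGen cell (j, c)` IS THE EVENT PRODUCT OF `pgenR rnw j c`** (births re-celled), for every
component `c ∈ comp j`, under `WF` and ANY admissible order: both are, level by level, the product over the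
constituents — a permutation of print's list — of the parts' products, one renewal factor per flagged part and one
birth factor per new region; a commutative product forgets the order. [folklore] -/
theorem evProd_toPGen_eq_pgenR (hW : H.WF) (hO : OrderOK H ord) :
    ∀ (j : ℕ) (c : γ), c ∈ H.comp j →
      evProd fB fR ((pedOf H rnw ord).toPGen cell (j, c)) =
        evProd (fun j d n => fB j d (cell n)) fR (H.pgenR rnw j c) := by
  intro j
  induction j with
  | zero =>
      intro c hc
      have hne : (rights (ord 0 c)).map (fun n => PGen.birth 0 (H.cls n) (cell n)) ≠ [] := by
        simpa using rights_ord_zero_ne_nil hW hO hc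
      rw [toPGen_zero H rnw ord cell hc, evProd_joinP fB fR _ _ hne, ComponentHistory.pgenR_zero_eq,
        evProd_assembleR _ _ c 0 _ (H.births_zero_ne_nil hW hc)]
      simp only [ComponentHistory.births, ComponentHistory.news, List.map_map, Function.comp_def, evProd_birth]
      exact ((perm_rights (hO 0 c hc)).map _).prod_eq
  | succ j ih =>
      intro c hc
      have hne : (ord (j + 1) c).map (fun q => Sum.elim
          (fun p => if rnw j p = true then PGen.renew ((pedOf H rnw ord).toPGen cell (j, p)) j
            else (pedOf H rnw ord).toPGen cell (j, p))
          (fun n => PGen.birth (j + 1) (H.cls n) (cell n)) q) ≠ [] := by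
        simpa using ord_ne_nil hW hO hc
      rw [toPGen_succ H rnw ord cell hc, evProd_joinP fB fR _ _ hne, ComponentHistory.pgenR_succ_eq,
        evProd_assembleR _ _ c (j + 1) _ (H.constituentsR_ne_nil rnw hW _ hc), ComponentHistory.constituentsR,
        List.map_map, List.map_map]
      have hfun : ∀ q ∈ ord (j + 1) c,
          (evProd fB fR ∘ fun q => Sum.elim
            (fun p => if rnw j p = true then PGen.renew ((pedOf H rnw ord).toPGen cell (j, p)) j
              else (pedOf H rnw ord).toPGen cell (j, p))
            (fun n => PGen.birth (j + 1) (H.cls n) (cell n)) q) q =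
          (evProd (fun j d n => fB j d (cell n)) fR ∘
            Sum.elim (wrapR rnw (H.pgenR rnw j) j) fun n => PGen.birth (j + 1) (H.cls n) n) q := by
        intro q hq
        cases q with
        | inr n => simp
        | inl p =>
            have hp : p ∈ H.comp j := hW.parts_sub j c hc p (mem_parts_of_inl_mem_ord hO hc hq)
            cases hr : rnw j p with
            | false => simp [hr, ih p hp]
            | true => simp [hr, ih p hp]
      rw [List.map_congr_left hfun]
      exact ((hO (j + 1) c hc).map _).prod_eq

end EvProdBridge

/-- the same with the identity payload map (the owner's `pedM` currency) [folklore] -/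
theorem evProd_toPGen_id_eq_pgenR {γ M : Type*} [CommMonoid M] [DecidableEq γ] [Inhabited γ]
    {H : ComponentHistory γ} {rnw : ℕ → γ → Bool} {ord : ℕ → γ → List (γ ⊕ γ)}
    (fB : ℕ → ℕ → γ → M) (fR : ℕ → M) (hW : H.WF) (hO : OrderOK H ord) {j : ℕ} {c : γ} (hc : c ∈ H.comp j) :
    evProd fB fR ((pedOf H rnw ord).toPGen id (j, c)) = evProd fB fR (H.pgenR rnw j c) :=
  evProd_toPGen_eq_pgenR fB fR id hW hO j c hc

/-- **FOR THE PROCESS**: the event product of the `pedM`-genealogy of a live component IS that of print's extraction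
`histM.pgenR rnwM` (the owner's chosen order `ordM` is admissible under `NewOK` and memory domination). [folklore] -/
theorem _root_.Summit.QuantumFields.BalabanUV.T4Continuum.HistoryGenealogyInstantiate.RunInputM.evProd_pedM_eq_pgenR
    {d : ℕ} {M : Type*} [CommMonoid M] (J : RunInputM d) (hN : J.NewOK) (hRm : ∀ t k, J.Rm t k ≤ J.R t)
    (fB : ℕ → ℕ → Lab d → M) (fR : ℕ → M) {j : ℕ} {c : Lab d} (hc : c ∈ J.histM.comp j) :
    evProd fB fR (J.pedM.toPGen id (j, c)) = evProd fB fR (J.histM.pgenR J.rnwM j c) :=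
  evProd_toPGen_id_eq_pgenR fB fR (J.wf_histM hN) (orderOK_ordOf (J.wf_histM hN) (J.levelClausesW_histM hN hRm)) hc

end Summit.QuantumFields.BalabanUV.T4Continuum.HistoryGenealogyPedigree

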